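import Summits.SmoothPoincare4.SmoothPoincare4.Theorems.SblfDescentRungOneHelperDxFamily
import Summits.SmoothPoincare4.SmoothPoincare4.Theorems.SblfDescentRungOneHelperDxAngle
import Literature.Topology.FourManifolds.TorusDiffeoLoops
import HarnessLib

/-!
# Disc extension, layer 4: straightening the loop of a base circle by Earle–Eells/Gramain

Auxiliary file of helper `helper_sliceGluing_discExtension` (apex leaf DX: extension of the
torus angular coordinate over the torus disc), line `Sketch`, crux `SblfDescent.RungOne`.

(Crux item stmt-SmoothPoincare4-18531; skeleton `Cruxes/RungOne/Lines/Sketch.lean`.)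

The flattened loop `loopD` of comparison diffeomorphisms of the torus fibre along the base
circle of radius `R` (layer 3) is a smooth based loop in `Diff(T²)`.  The named fact
`gramain_loopHomotopy_translationLoop_torus` (Earle–Eells 1969, Gramain 1973; hypothesis
`hEE`) deforms it, through based loops, to the loop of translations by `D_t v₀ · v₀⁻¹`.  This
file packages the output (`exists_loopFamily`): jointly smooth mutually inverse two-parameter
families `P σ t`, `Pinv σ t` of self-maps of `T = Circle × Circle` with `P 1 t = loopD_t`,
`P σ t = id` for `t ∉ (0, 1)`, and — the **degree-free use of the winding hypothesis** — the
first component of the translation loop written as `Circle.exp (2π g t)` for a *smooth*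
`1`-periodic real function `g` vanishing near the integers: the evaluation `t ↦ (D_t v₀).1` is
the hypothesis loop `t ↦ aC (ιT (θ₁, R • circlePt t))` reparametrised by `perStep`, whose
continuous periodic lift `L` gives `g = L ∘ perStep - L 0`, smooth because its exponential is
(`contDiff_of_continuous_of_contMDiff_circleExp`).
-/

set_option linter.dupNamespace false

noncomputable section

open scoped Manifold ContDiff Topology Real
open Set Function Metric Literature.Topology.FourManifolds

namespace Summit.SmoothPoincare4.SmoothPoincare4.Cruxes.RungOne.Sketch

namespace DiscExt

/-- Local notation: `𝔼 n` is the model Euclidean space `EuclideanSpace ℝ (Fin n)`. -/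
local notation "𝔼 " n:arg => EuclideanSpace ℝ (Fin n)

/-- Local notation: `𝕊¹`, the unit circle of `ℝ²`. -/
local notation "𝕊¹" => (Metric.sphere (0 : EuclideanSpace ℝ (Fin 2)) (1 : ℝ))

/-- Local notation: `𝕊²`, the unit sphere of `ℝ³`. -/
local notation "𝕊²" => (Metric.sphere (0 : EuclideanSpace ℝ (Fin 3)) (1 : ℝ))

/-- Local notation: the model with corners of the torus `Circle × Circle`. -/
local notation "𝓣" => (ModelWithCorners.prod (𝓡 1) (𝓡 1))

attribute [local instance] Literature.Topology.FourManifolds.fact_finrank_euclideanSpace_succ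

/-! ### Construction -/

section Setup

variable {X : Type} [TopologicalSpace X] [ChartedSpace (𝔼 4) X]
  {Fb : Type} [TopologicalSpace Fb] [ChartedSpace (𝔼 2) Fb] [Nonempty Fb]
  {f : X → 𝕊²} {v : 𝕊²} {ιT : Fb × 𝔼 2 → X}
  {ν : 𝕊¹ × 𝔼 3 → X} {σ : ℝ} {g : ℝ → ℝ} {s₁ s₂ ε₂ : ℝ}
  {ιC : (𝕊¹ × 𝕊¹) × (𝕊¹ × ℝ) → X} {aC bC : X → 𝕊¹}

/-- A continuous `1`-periodic lift `L` of the hypothesis loop gives the **phase function**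
`t ↦ L (perStep t) - L 0`: continuous, `1`-periodic, vanishing near the integers. [folklore] -/
theorem phase_props {L : ℝ → ℝ} (hLc : Continuous L) (hLp : ∀ t, L (t + 1) = L t) :
    Continuous (fun t ↦ L (perStep t) - L 0) ∧ (∀ t, L (perStep (t + 1)) - L 0 = L (perStep t) - L 0) ∧
      ∀ (t : ℝ) (n : ℤ), |t - n| < 1 / 4 → L (perStep t) - L 0 = 0 := by
  refine ⟨(hLc.comp continuous_perStep).sub continuous_const, fun t ↦ by rw [perStep_add_one, hLp],
    fun t n h ↦ ?_⟩
  rw [perStep_of_abs_lt h, sub_eq_zero]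
  simpa using periodic_int_shift hLp 0 n

/-- **The straightened loop family of a base circle.**  Given the Earle–Eells/Gramain fact, the
torus side and a rigid collar, a base circle of radius `R > 0` inside the band, a point `θ₁` of
the fibre, and a continuous `1`-periodic lift `L` of the angular coordinate along that circle
(`aC (ιT (θ₁, R • circlePt t)) = circlePt (L t)`, the vanishing of the degree), the flattened
loop `loopD` of comparison diffeomorphisms straightens: there are jointly smooth, mutually
inverse two-parameter families `P σ t`, `Pinv σ t` of self-maps of `T = Circle × Circle` with
`P 1 t = ΘT w₀ (R • circlePt (stepQ t))` (`w₀ = R • circlePt 0`), `P σ t = id` for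
`t ∉ (0, 1)`, and `(P 0 (stepQ (fract t)) x).1 = Circle.exp (2π g t) * x.1` for a smooth
`1`-periodic `g` vanishing near `ℤ`. [cite: Gramain1973, Théorème 1 (p. 54) and §1 "Le tore" (p. 57)] -/
theorem exists_loopFamily (hEE : gramain_loopHomotopy_translationLoop_torus)
    (hT : IsTorusSideProduct f v ιT) (hC : IsRigidCollar f v ν σ g s₁ s₂ ε₂ ιC aC bC)
    (hv0 : (v : 𝔼 3) 0 = 0) (hv1 : (v : 𝔼 3) 1 = 0) {R : ℝ} (hR : 0 < R)
    (h1 : s₁ < (1 + 2 * R ^ 2)⁻¹) (h2 : (1 + 2 * R ^ 2)⁻¹ < s₂) (θ₁ : Fb)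
    (hL : ∃ L : ℝ → ℝ, Continuous L ∧ (∀ t, L (t + 1) = L t) ∧
      ∀ t : ℝ, aC (ιT (θ₁, R • ((circlePt t : 𝕊¹) : 𝔼 2))) = circlePt (L t)) :
    ∃ (P Pinv : ℝ → ℝ → Circle × Circle → Circle × Circle) (gφ : ℝ → ℝ),
      ContMDiff (𝓘(ℝ, ℝ).prod (𝓘(ℝ, ℝ).prod 𝓣)) 𝓣 ∞
        (fun p : ℝ × (ℝ × (Circle × Circle)) ↦ P p.1 p.2.1 p.2.2) ∧
      ContMDiff (𝓘(ℝ, ℝ).prod (𝓘(ℝ, ℝ).prod 𝓣)) 𝓣 ∞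
        (fun p : ℝ × (ℝ × (Circle × Circle)) ↦ Pinv p.1 p.2.1 p.2.2) ∧
      (∀ σ t x, Pinv σ t (P σ t x) = x) ∧ (∀ σ t x, P σ t (Pinv σ t x) = x) ∧
      (∀ t x, P 1 t x = ΘT v ιT ιC aC bC (R • ((circlePt 0 : 𝕊¹) : 𝔼 2))
        (R • ((circlePt (stepQ t) : 𝕊¹) : 𝔼 2)) x) ∧
      (∀ σ t, t ≤ 0 ∨ 1 ≤ t → ∀ x, P σ t x = x) ∧
      (∀ t x, (P 0 (stepQ (Int.fract t)) x).1 = Circle.exp (2 * π * gφ t) * x.1) ∧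
      ContDiff ℝ ∞ gφ ∧ (∀ t, gφ (t + 1) = gφ t) ∧
      ∀ (t : ℝ) (n : ℤ), |t - n| < 1 / 4 → gφ t = 0 := by
  obtain ⟨L, hLc, hLp, hLa⟩ := hL
  have hw₀ : (R • ((circlePt 0 : 𝕊¹) : 𝔼 2)) ≠ 0 := smul_circlePt_ne_zero hR 0
  have h1₀ : s₁ < sT (R • ((circlePt 0 : 𝕊¹) : 𝔼 2)) := by rw [sT_smul_circlePt]; exact h1
  have h2₀ : sT (R • ((circlePt 0 : 𝕊¹) : 𝔼 2)) < s₂ := by rw [sT_smul_circlePt]; exact h2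
  have hD0 : ∀ t ≤ (0 : ℝ), (loopD hT hC hv0 hv1 hR h1 h2).toFun t = id := fun t ht ↦
    loopD_toFun_of_le hT hC hv0 hv1 hR h1 h2 (by linarith)
  have hD1 : ∀ t, (1 : ℝ) ≤ t → (loopD hT hC hv0 hv1 hR h1 h2).toFun t = id := fun t ht ↦
    loopD_toFun_of_ge hT hC hv0 hv1 hR h1 h2 (by linarith)
  obtain ⟨P, Pinv, hPs, hPinvs, hPinvP, hPPinv, hP1, hP0, hPid, -⟩ :=
    hEE (loopD hT hC hv0 hv1 hR h1 h2) (Ψ0 ιT aC bC (R • ((circlePt 0 : 𝕊¹) : 𝔼 2)) θ₁) hD0 hD1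
  -- the evaluation of the loop: `(D_s v₀).1 = exp (2π L (stepQ s))`
  have heval : ∀ s, ((loopD hT hC hv0 hv1 hR h1 h2).toFun s
      (Ψ0 ιT aC bC (R • ((circlePt 0 : 𝕊¹) : 𝔼 2)) θ₁)).1 = Circle.exp (2 * π * L (stepQ s)) := by
    intro s
    rw [loopD_toFun_Ψ0_fst hT hC hv0 hv1 hR h1 h2, hLa, toCircle_circlePt]
  have hv₀1 : (Ψ0 ιT aC bC (R • ((circlePt 0 : 𝕊¹) : 𝔼 2)) θ₁).1 = Circle.exp (2 * π * L 0) := by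
    have h := heval 0
    rw [hD0 0 le_rfl, stepQ_zero] at h
    exact h
  -- the phase function `gφ = L ∘ perStep - L 0`
  obtain ⟨hgc, hgp, hgflat⟩ := phase_props hLc hLp
  have hLper : ∀ t, L (stepQ (stepQ (Int.fract t))) = L (perStep t) := by
    intro t
    rw [perStep, add_comm]
    exact (periodic_int_shift hLp _ ⌊t⌋).symm
  have hexpand : ∀ t, Circle.exp (2 * π * (L (perStep t) - L 0)) =
      Circle.exp (2 * π * L (perStep t)) * (Circle.exp (2 * π * L 0))⁻¹ := by
    intro t
    rw [show 2 * π * (L (perStep t) - L 0) = 2 * π * L (perStep t) + -(2 * π * L 0) by ring,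
      Circle.exp_add, Circle.exp_neg]
  have hP0' : ∀ t x, (P 0 (stepQ (Int.fract t)) x).1 =
      Circle.exp (2 * π * (L (perStep t) - L 0)) * x.1 := by
    intro t x
    rw [hP0, heval, hv₀1, hLper, hexpand]
  -- smoothness of the phase: its exponential is the (smooth) evaluation of the loop at `perStep`
  have hexp : ContMDiff 𝓘(ℝ, ℝ) (𝓡 1) ∞ fun t ↦ Circle.exp (2 * π * (L (perStep t) - L 0)) := by
    have hΘ := contMDiff_ΘT_circle hT hC hv0 hv1 h1₀ h2₀ h1 h2 contDiff_perStep
    have hpair : ContMDiff 𝓘(ℝ, ℝ) (𝓘(ℝ, ℝ).prod 𝓣) ∞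
        fun t : ℝ ↦ ((t, Ψ0 ιT aC bC (R • ((circlePt 0 : 𝕊¹) : 𝔼 2)) θ₁) : ℝ × (Circle × Circle)) :=
      contMDiff_id.prodMk contMDiff_const
    -- (compose first, restate afterwards: elaborating `comp` against the target lambda is slow)
    have h3 := contMDiff_fst.comp (hΘ.comp hpair)
    have h3' : ContMDiff 𝓘(ℝ, ℝ) (𝓡 1) ∞ fun t : ℝ ↦
        (ΘT v ιT ιC aC bC (R • ((circlePt 0 : 𝕊¹) : 𝔼 2)) (R • ((circlePt (perStep t) : 𝕊¹) : 𝔼 2))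
          (Ψ0 ιT aC bC (R • ((circlePt 0 : 𝕊¹) : 𝔼 2)) θ₁)).1 := h3
    have h4 : ContMDiff 𝓘(ℝ, ℝ) (𝓡 1) ∞ fun t : ℝ ↦
        (ΘT v ιT ιC aC bC (R • ((circlePt 0 : 𝕊¹) : 𝔼 2)) (R • ((circlePt (perStep t) : 𝕊¹) : 𝔼 2))
          (Ψ0 ιT aC bC (R • ((circlePt 0 : 𝕊¹) : 𝔼 2)) θ₁)).1 *
          ((Ψ0 ιT aC bC (R • ((circlePt 0 : 𝕊¹) : 𝔼 2)) θ₁).1)⁻¹ :=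
      h3'.mul contMDiff_const
    refine h4.congr fun t ↦ ?_
    rw [ΘT_Ψ0_fst hT hC hv0 hv1 hw₀ h1₀ h2₀, hLa, toCircle_circlePt, hv₀1, hexpand]
  have hgs : ContDiff ℝ ∞ fun t ↦ L (perStep t) - L 0 := contDiff_of_continuous_of_contMDiff_circleExp hgc hexp
  refine ⟨P, Pinv, fun t ↦ L (perStep t) - L 0, hPs, hPinvs, hPinvP, hPPinv, fun t x ↦ ?_, hPid, hP0',
    hgs, hgp, hgflat⟩
  rw [hP1, loopD_toFun]

end Setup

end DiscExt

end Summit.SmoothPoincare4.SmoothPoincare4.Cruxes.RungOne.Sketch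

end
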